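import Mathlib
import Summits.MatrixMultiplication.MatrixMultiplication.Theses.FourierTwoFamiliesModP

/-!
# Line `delta-trace-rigidity` for crux `PrimeLogDecay` (stmt-MatrixMultiplication-14310)

Skeleton (crux-plan, planner, 2026-08-16).  Route decl:
`Summit.MatrixMultiplication.MatrixMultiplication.Theses.FourierTwoFamiliesModP.PrimeLogDecay`
(`∃ c > 0 ∃ s₀, ∀ p prime, ∀ balanced SDPP (A i, B i)_{i<n} in ZMod p with |A i| = |B i| = s ≥ s₀,
n·s·(log s)^c ≤ p`).

## The lever, as cut here

Notation: `X = ⊔ A i`, `Y = ⊔ B i`, `Δ = ⋃ⱼ (A j − B j)` (the MATCHED-DIFFERENCE SET), `ρ = n s / p`,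
`D = p / s²` (dilution), `Ψ = ρ s` (wall ratio), `L = log(1/ρ)`.

Conditioning on `Δ` makes (X) PAIRWISE (`disjoint_sub_delta`: `(A i − B k) ∩ Δ = ∅` for `i ≠ k`) and
yields the exact TRACE IDENTITY (`trace_identity`, proved below): for `x ∈ A i`,
`Y ∩ (x − Δ) = B i`.  Two consequences organise the whole line.

* ANALYTIC SIDE.  The convolution `1_Y ∗ 1_Δ` is IDENTICALLY `s` on `X` while its mean is `ρ|Δ| ≥ Ψ·s`:
  the X-tested deficit `⟨μ_Y ∗ μ_Δ, μ_X⟩ ≤ 1/Ψ`.  It is HEREDITARY in the strongest sense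
  (`trace_deficit`: for every window `W` and every part `Δ' ⊆ Δ`, a point of `A i` sees at most `|B i|`
  points of `Y ∩ W` across `Δ'`), so inside Bohr windows the test set stays the dense set `X` and the
  sparse factor is the ORIGINAL `Δ` (relative density `≥ 1/D`), never the quadratically shrinking set of
  fragment differences.  A Kelley–Meka decoupling/sifting iteration therefore costs `poly(L, log D)` per
  round with NO tower, and its budget (`log Ψ ≤ log s`) is met exactly when the host is PINNED,
  `log D ≤ (log s)^κ` (`κ < 1/6` on Bloom–Sisask's printed exponents).  That is `stub_pinnedLogDecay`.
* STRUCTURAL SIDE.  For dilute hosts (`log D > (log s)^κ`) the same identity read at two points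
  `x, x + d ∈ A i` is TRACE RIGIDITY (`trace_rigidity`: `x − y ∈ Δ ↔ x + d − y ∈ Δ` for every `y ∈ Y`,
  i.e. `Δ △ (Δ − d)` avoids `x − Y`): either `Y` fails to expand against `Δ △ (Δ − d)` or the realised
  internal block differences are almost-periods of `Δ`, and blocks sit in few translates of the
  approximate group `Per_η(Δ)`.  The consumable form of this localization is `stub_rehostableSubfamily`:
  a dense configuration has a sub-family `I` of polynomially comparable density that RE-HOSTS into a pinned
  prime cyclic group through a map `φ` REFLECTING the 4-term relation `(a − a') + (b − b') = 0`
  (a Freiman-type isomorphism of the configuration, nothing more is needed: `stub_freimanRehost`).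

Why re-hosting is stated through `Reflects` and not through interval windows: rank-1 ("paired arc")
localization is crux-strength — the product of any family `F` with the `s = 2` translate design in a huge
`ℤ/q` has density `ρ_F / 2`, yet any two `A`-points of one of its blocks differ by a non-zero multiple of
`q` under every dilation, so no arc shorter than `q` holds a whole block; the same product DOES re-host
(restrict the gadget's index translates to a short interval of `ℤ/q`: a rank-2 Freiman image).  Hence the
minor/`Reflects` form, which every localization mechanism (Bohr rank ≥ 2 included) feeds.

Composition (`PrimeLogDecay_of`, kernel-checked): `stub_pinnedLogDecay` supplies `κ, c₂, s₂`;
`stub_rehostableSubfamily` at that `κ` supplies `c₁, C, s₁`; with `c = min c₁ (c₂/C)` and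
`s₀ = max s₁ s₂ 3`, a configuration is either sparse outright, or re-hosts (via `stub_freimanRehost`) to a
pinned configuration of density `≥ ρ^C`, where `stub_pinnedLogDecay` gives `ρ^C ≤ (log s)^{-c₂}`.

Disproof obligations honoured (landed `Theorems/PrimeLogDecay/Negative/LoadBearing.lean`):
`primeLogDecay_false_without_W` / `_without_X` — both open stubs carry (W) and (X) verbatim as hypotheses
(`IsW`, `IsX`), and the line USES them: (X) is the trace identity itself (`trace_identity` needs only (X)),
(W) enters `stub_pinnedLogDecay` through `|Δ| ≥ |A i − B i| = s²` (the deficit `1/Ψ`) and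
`stub_freimanRehost` through block-injectivity of `φ`; `not_primeLogDecayWith_13_3` — no explicit constants
are claimed (`∃ c ∃ s₀` throughout); `card_translateClass_mul_le` / chain menus (`ChainMenuDesign.lean`) —
translates (`ρ = 1/s`) and chain-menu CRT designs (`ρ = s^{-0.585}`, dilution `s^{1.585}`, NOT pinned) sit in
the sparse disjunct of `stub_rehostableSubfamily` and below every bound of `stub_pinnedLogDecay`.
-/

set_option linter.dupNamespace false

namespace Summit.MatrixMultiplication.MatrixMultiplication.Cruxes.PrimeLogDecay.DeltaTraceRigidity

open scoped BigOperators Pointwise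
open Summit.MatrixMultiplication.MatrixMultiplication.Theses.FourierTwoFamiliesModP

/-- Sanity: the crux decl resolves by name. -/
example : Prop := PrimeLogDecay

/-! ## Objects (the route's clauses verbatim, named) -/

/-- Balanced: every block has size `s`. -/
def IsBalanced {p n : ℕ} (s : ℕ) (A B : Fin n → Finset (ZMod p)) : Prop :=
  ∀ i : Fin n, (A i).card = s ∧ (B i).card = s

/-- (W): each `A i ⊕ B i` is direct — verbatim the route's clause. -/
def IsW {p n : ℕ} (A B : Fin n → Finset (ZMod p)) : Prop :=
  ∀ i : Fin n, ∀ a ∈ A i, ∀ a' ∈ A i, ∀ b ∈ B i, ∀ b' ∈ B i, (a - a') + (b - b') = 0 → a = a' ∧ b = b'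

/-- (X): the cross clause of the simultaneous double product property — verbatim the route's clause. -/
def IsX {p n : ℕ} (A B : Fin n → Finset (ZMod p)) : Prop :=
  ∀ i j k : Fin n, ∀ a ∈ A i, ∀ a' ∈ A j, ∀ b ∈ B j, ∀ b' ∈ B k, (a - a') + (b - b') = 0 → i = k

/-- PINNED hosts: `p ≤ s² · exp((log s)^κ)`, i.e. dilution `D = p/s² ≤ exp((log s)^κ)`. -/
noncomputable def pinBound (κ : ℝ) (s : ℕ) : ℝ :=
  (s : ℝ) ^ 2 * Real.exp (Real.log (s : ℝ) ^ κ)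

/-- `φ : ZMod p → ZMod p'` REFLECTS the SDPP 4-term relation on the sub-family `I` — the only thing
re-hosting needs (a Freiman-2-isomorphism-type condition on mixed quadruples
`(a, a', b, b') ∈ A i × A j × B j × B k`, `i, j, k ∈ I`; it contains the quadruples of (W), `i = j = k`). -/
def Reflects {p p' n : ℕ} (A B : Fin n → Finset (ZMod p)) (I : Finset (Fin n))
    (φ : ZMod p → ZMod p') : Prop :=
  ∀ i ∈ I, ∀ j ∈ I, ∀ k ∈ I, ∀ a ∈ A i, ∀ a' ∈ A j, ∀ b ∈ B j, ∀ b' ∈ B k,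
    (φ a - φ a') + (φ b - φ b') = 0 → (a - a') + (b - b') = 0

/-- The matched-difference set `Δ = ⋃ⱼ (A j − B j)`. -/
def delta {p n : ℕ} (A B : Fin n → Finset (ZMod p)) : Finset (ZMod p) :=
  Finset.univ.biUnion fun j => A j - B j

/-- `⊔ᵢ A i` (used as `X = union A`, `Y = union B`). -/
def union {p n : ℕ} (A : Fin n → Finset (ZMod p)) : Finset (ZMod p) :=
  Finset.univ.biUnion A

/-! ## The lever, proved (tools for both open stubs; no `sorry`) -/

/-- F0, PAIRWISE FORM of (X): `(A i − B k) ∩ Δ = ∅` for `i ≠ k` (the free middle index is gone). -/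
theorem disjoint_sub_delta {p n : ℕ} {A B : Fin n → Finset (ZMod p)} (hX : IsX A B)
    {i k : Fin n} (hik : i ≠ k) : Disjoint (A i - B k) (delta A B) := by
  rw [Finset.disjoint_left]
  intro d hd hd'
  obtain ⟨a, ha, b', hb', rfl⟩ := Finset.mem_sub.1 hd
  simp only [delta, Finset.mem_biUnion, Finset.mem_univ, true_and] at hd'
  obtain ⟨j, hj⟩ := hd'
  obtain ⟨a', ha', b, hb, he⟩ := Finset.mem_sub.1 hj
  exact hik (hX i j k a ha a' ha' b hb b' hb' (by linear_combination -he))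

/-- F1, TRACE IDENTITY: for `x ∈ A i` the translate `x − Δ` cuts exactly the block `B i` out of
`Y = ⊔ B k`.  (Only (X) is used.)  Hence `1_Y ∗ 1_Δ ≡ s` on `X` for balanced families. -/
theorem trace_identity {p n : ℕ} {A B : Fin n → Finset (ZMod p)} (hX : IsX A B)
    {i : Fin n} {x : ZMod p} (hx : x ∈ A i) :
    (union B).filter (fun y => x - y ∈ delta A B) = B i := by
  ext y
  simp only [Finset.mem_filter, union, delta, Finset.mem_biUnion, Finset.mem_univ, true_and]
  constructor
  · rintro ⟨⟨k, hk⟩, j, hj⟩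
    obtain ⟨a', ha', b, hb, he⟩ := Finset.mem_sub.1 hj
    have hik : i = k := hX i j k x hx a' ha' b hb y hk (by linear_combination -he)
    subst hik
    exact hk
  · intro hy
    exact ⟨⟨i, hy⟩, i, Finset.sub_mem_sub hx hy⟩

/-- HEREDITARY TRACE DEFICIT (the input of every round behind `stub_pinnedLogDecay`): inside ANY window
`W` and against ANY part `Δ' ⊆ Δ`, a point `x ∈ A i` sees at most `|B i|` points `y ∈ Y ∩ W` with
`x − y ∈ Δ'`.  So the count of `Δ'`-differences on `(X ∩ W₁) × (Y ∩ W₂)` is `≤ s·|X ∩ W₁|`, against the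
random benchmark `|X ∩ W₁| |Y ∩ W₂| |Δ'| / |W₁ − W₂|`: the test set is the dense set `X`, the sparse
factor is a piece of the ORIGINAL `Δ` — fragments of blocks never enter. -/
theorem trace_deficit {p n : ℕ} {A B : Fin n → Finset (ZMod p)} (hX : IsX A B)
    {i : Fin n} {x : ZMod p} (hx : x ∈ A i) (W Δ' : Finset (ZMod p)) (hΔ : Δ' ⊆ delta A B) :
    ((union B ∩ W).filter (fun y => x - y ∈ Δ')).card ≤ (B i).card := by
  rw [← trace_identity hX hx]
  apply Finset.card_le_card
  intro y hy
  simp only [Finset.mem_filter, Finset.mem_inter] at hy ⊢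
  exact ⟨hy.1.1, hΔ hy.2⟩

/-- F6, TRACE RIGIDITY: two points `x, x + d` of one block see `Y` through `Δ` identically —
`Δ △ (Δ − d)` avoids `x − Y`.  Popular internal block differences are thus almost-periods of `Δ`
whenever `Y` expands; this is the entry point of `stub_rehostableSubfamily`. -/
theorem trace_rigidity {p n : ℕ} {A B : Fin n → Finset (ZMod p)} (hX : IsX A B)
    {i : Fin n} {x d : ZMod p} (hx : x ∈ A i) (hxd : x + d ∈ A i) {y : ZMod p} (hy : y ∈ union B) :
    x - y ∈ delta A B ↔ x + d - y ∈ delta A B := by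
  have h1 := trace_identity hX hx
  have h2 := trace_identity hX hxd
  have key : y ∈ (union B).filter (fun y => x - y ∈ delta A B) ↔
      y ∈ (union B).filter (fun y => x + d - y ∈ delta A B) := by rw [h1, h2]
  simp only [Finset.mem_filter] at key
  constructor
  · intro h; exact (key.1 ⟨hy, h⟩).2
  · intro h; exact (key.2 ⟨hy, h⟩).2

/-! ## Stub statements (namespace `Spec`: the Props, named like the registered stubs so that the
hypotheses of `PrimeLogDecay_of` are admissible BY NAME for the skeleton audit) -/

namespace Spec

/-- STUB 1 — `stub_rehostableSubfamily` (HOST REDUCTION by localization; OPEN, size XL; the HARDEST stub,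
the structural bet of the line).  For every pinning exponent `κ ∈ (0,1)` there are `c₁ > 0`, `C ≥ 1`, `s₁`
such that every balanced SDPP configuration in `ZMod p` with `s ≥ s₁` is EITHER sparse outright
(`n s (log s)^{c₁} ≤ p`) OR has a sub-family `I` and a map `φ : ZMod p → ZMod p'`, `p'` prime and PINNED
(`p' ≤ s²·exp((log s)^κ)`), reflecting the 4-term relation on `I`, with polynomially comparable density
`(n s / p)^C ≤ |I| s / p'`.  Trivial when `p` itself is pinned (`φ = id`, `I = univ`, `C = 1`): the content is
the DILUTE regime `p > s² exp((log s)^κ)`.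
Why plausible: by `trace_rigidity`, for `x, x+d ∈ A i` the set `Y + (Δ △ (Δ − d))` misses `x`; summing,
`Σ_d |X_d| = n s (s−1) ≈ Ψ p`, so either `Y` (density `ρ`) fails to expand against the sets `Δ △ (Δ − d)`
(structure at Bohr scale) or the realised internal differences are `O((log p)/ρ)`-almost-periods of `Δ`,
`Per_η(Δ) − Per_η(Δ) ⊆ Per_{2η}(Δ)`, `|Per_{2η}(Δ)| ≤ |Δ|/(1 − 2η)` (approximate group; Freiman/Green–Ruzsa
in `ZMod p`), and blocks sit in few translates of a bounded-rank Bohr set; the pairwise form of (X)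
(`disjoint_sub_delta`) then groups the B-partners into few offset classes, and a Bohr cell pair of rank `r`
re-hosts by the carry-free mixed-radix Freiman map (as in the route's CyclicReduction) with density loss
`2^{O(r)}`, `r = O(L / log log s)` for `ρ ≥ (log s)^{-c₁}` — polynomial in `1/ρ`, whence the exponent `C`.
Localization driven by `L = log(1/ρ)` lands at scale `s²·exp(L^{O(1)}) ≪ s² exp((log s)^κ)` for every
`κ > 0`, which is why `κ` is universally quantified.
Why it might fail: a dense family whose blocks are Sidon-like AND whose union `Y` expands against every
`Δ △ (Δ − d)` has no almost-periods to work with; then nothing localizes and the only exit is that such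
families are automatically sparse (the card's concession) — unproved.  Known designs do not test it
(densest: chain menus `ρ = s^{-0.585}`, sparse disjunct).  Rank-1 (arc) localization would be FALSE here
(products with the `s = 2` gadget in a huge `ℤ/q`, module docstring), hence the `Reflects` form. -/
def stub_rehostableSubfamily : Prop :=
  ∀ κ : ℝ, 0 < κ → κ < 1 → ∃ c₁ : ℝ, 0 < c₁ ∧ ∃ C : ℕ, 1 ≤ C ∧ ∃ s₁ : ℕ,
    ∀ p : ℕ, p.Prime → ∀ (n s : ℕ) (A B : Fin n → Finset (ZMod p)), s₁ ≤ s →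
      IsBalanced s A B → IsW A B → IsX A B →
      (n : ℝ) * (s : ℝ) * Real.log (s : ℝ) ^ c₁ ≤ (p : ℝ) ∨
      ∃ (p' : ℕ) (I : Finset (Fin n)) (φ : ZMod p → ZMod p'), p'.Prime ∧
        (p' : ℝ) ≤ pinBound κ s ∧ Reflects A B I φ ∧
        ((n : ℝ) * (s : ℝ) / (p : ℝ)) ^ C ≤ (I.card : ℝ) * (s : ℝ) / (p' : ℝ)

/-- STUB 2 — `stub_freimanRehost` (FREIMAN RE-HOSTING; PROVABLE NOW, size M).  If `φ` reflects the 4-term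
relation on the sub-family `I` of a balanced SDPP configuration, then the images `(φ(A i), φ(B i))_{i ∈ I}`,
re-indexed by `Fin |I|`, form a balanced SDPP configuration with the same block size in `ZMod p'`.
Proof sketch: (W'),(X') — a relation among images reflects to a relation in `ZMod p`, where (W)/(X) apply
(and `I ≃ Fin |I|` is injective); block sizes — `φ` is injective on each `A i` (take `b = b' ∈ B i`, which is
non-empty when `s ≥ 1`; `s = 0` is trivial) and on each `B i` likewise, so `card_image_of_injOn`.
Neither primality nor any property of `φ` off the blocks is needed. -/
def stub_freimanRehost : Prop :=
  ∀ (p p' n s : ℕ) (A B : Fin n → Finset (ZMod p)) (I : Finset (Fin n)) (φ : ZMod p → ZMod p'),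
    IsBalanced s A B → IsW A B → IsX A B → Reflects A B I φ →
    ∃ (A' B' : Fin I.card → Finset (ZMod p')), IsBalanced s A' B' ∧ IsW A' B' ∧ IsX A' B'

/-- STUB 3 — `stub_pinnedLogDecay` (LOG-POWER DECAY IN PINNED HOSTS; OPEN, size XL; the analytic engine).
For some pinning exponent `κ ∈ (0,1)`: balanced SDPP configurations in `ZMod p` with
`p ≤ s²·exp((log s)^κ)` have density `n s / p ≤ (log s)^{-c₂}` once `s ≥ s₂`.  This is the crux restricted to
quasi-polynomial dilution `D ≤ exp((log s)^κ)` — the regime adjacent to the route's RemovalRegime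
(`n ≤ K s`, i.e. `D ≤ K/ρ`, PROVED in tree at tower rate), with a log-power RATE demanded.
Why plausible (the engine): by `trace_identity`, `⟨μ_Y ∗ μ_Δ, μ_X⟩ ≤ 1/Ψ` with `X` dense (`ρ`), `Y` dense
(`ρ`) and `Δ` of density `δ ≥ s²/p ≥ exp(−(log s)^κ)`; Kelley–Meka decoupling (arXiv:2302.05537 Prop 2.12)
and sifting/unbalancing (Thm 2.8 / 2.11) with Bloom–Sisask's Bohr-set increments (arXiv:2302.07211 Prop 14,
Lemma 15, Thm 16) give a `×(1 + Ω(1))` relative-density increment of `Y` (at cost `poly(L)`) or of `Δ`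
(at cost `poly(log(1/δ)) = (log s)^{O(κ)}`) per round; `trace_deficit` keeps the identity valid for block
FRAGMENTS in windows with the ORIGINAL `Δ` as sparse factor, so the Hölder exponent never towers;
`O(L) + O((log s)^κ)` rounds of total Bohr-size cost `exp(−(log s)^{6κ+o(1)})` fit the occupancy budget
`log Ψ ≈ log s` iff `κ < 1/6`.  Needs a Bohr-set / regularity API (not in Mathlib) and the vendored KM/BS facts.
Why it might fail: the THREE-WINDOW COUPLING — each round must place the `X`-window at `x`, the
`Y`-window at `y` and see `Δ` still `2^{-O(t)}δ`-dense in the difference window at `x − y`; when the irregular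
factor of the decoupling is `Δ`, following its increment while keeping `X` and `Y` dense is not guaranteed
(the dual trace identity `X ∩ (y + Δ) = A i` for `y ∈ B i` makes `X` and `y + Δ` maximally anti-correlated
exactly at `y ∈ Y`); if that branch cannot be steered the iteration proves only the one-round statement. -/
def stub_pinnedLogDecay : Prop :=
  ∃ κ : ℝ, 0 < κ ∧ κ < 1 ∧ ∃ c₂ : ℝ, 0 < c₂ ∧ ∃ s₂ : ℕ,
    ∀ p : ℕ, p.Prime → ∀ (n s : ℕ) (A B : Fin n → Finset (ZMod p)), s₂ ≤ s →
      IsBalanced s A B → IsW A B → IsX A B → (p : ℝ) ≤ pinBound κ s →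
      (n : ℝ) * (s : ℝ) * Real.log (s : ℝ) ^ c₂ ≤ (p : ℝ)

end Spec

/-! ## Registered stubs (statement text = the corresponding `Spec.stub_…`, verbatim; `PrimeLogDecay_proof`
below makes the kernel enforce the agreement) -/

/-- Registered stub 1 — see `Spec.stub_rehostableSubfamily` (OPEN, XL, hardest). -/
theorem stub_rehostableSubfamily :
    ∀ κ : ℝ, 0 < κ → κ < 1 → ∃ c₁ : ℝ, 0 < c₁ ∧ ∃ C : ℕ, 1 ≤ C ∧ ∃ s₁ : ℕ,
      ∀ p : ℕ, p.Prime → ∀ (n s : ℕ) (A B : Fin n → Finset (ZMod p)), s₁ ≤ s →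
        IsBalanced s A B → IsW A B → IsX A B →
        (n : ℝ) * (s : ℝ) * Real.log (s : ℝ) ^ c₁ ≤ (p : ℝ) ∨
        ∃ (p' : ℕ) (I : Finset (Fin n)) (φ : ZMod p → ZMod p'), p'.Prime ∧
          (p' : ℝ) ≤ pinBound κ s ∧ Reflects A B I φ ∧
          ((n : ℝ) * (s : ℝ) / (p : ℝ)) ^ C ≤ (I.card : ℝ) * (s : ℝ) / (p' : ℝ) := by
  sorry

/-- Registered stub 2 — see `Spec.stub_freimanRehost` (PROVABLE NOW, M). -/
theorem stub_freimanRehost :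
    ∀ (p p' n s : ℕ) (A B : Fin n → Finset (ZMod p)) (I : Finset (Fin n)) (φ : ZMod p → ZMod p'),
      IsBalanced s A B → IsW A B → IsX A B → Reflects A B I φ →
      ∃ (A' B' : Fin I.card → Finset (ZMod p')), IsBalanced s A' B' ∧ IsW A' B' ∧ IsX A' B' := by
  sorry

/-- Registered stub 3 — see `Spec.stub_pinnedLogDecay` (OPEN, XL). -/
theorem stub_pinnedLogDecay :
    ∃ κ : ℝ, 0 < κ ∧ κ < 1 ∧ ∃ c₂ : ℝ, 0 < c₂ ∧ ∃ s₂ : ℕ,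
      ∀ p : ℕ, p.Prime → ∀ (n s : ℕ) (A B : Fin n → Finset (ZMod p)), s₂ ≤ s →
        IsBalanced s A B → IsW A B → IsX A B → (p : ℝ) ≤ pinBound κ s →
        (n : ℝ) * (s : ℝ) * Real.log (s : ℝ) ^ c₂ ≤ (p : ℝ) := by
  sorry

/-! ## Composition (kernel-checked, no sorry) -/

/-- The three stubs prove the crux BY NAME.  `stub_pinnedLogDecay` gives `κ, c₂, s₂`;
`stub_rehostableSubfamily κ` gives `c₁, C, s₁`; put `c := min c₁ (c₂ / C)`, `s₀ := max (max s₁ s₂) 3`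
(so `log s ≥ 1`).  A configuration with `s ≥ s₀` is either sparse at exponent `c₁ ≥ c`, or re-hosts
(`stub_freimanRehost`) into a pinned prime host at density `ρ' ≥ ρ^C`, where `stub_pinnedLogDecay` gives
`ρ'·(log s)^{c₂} ≤ 1`; hence `(ρ·(log s)^{c₂/C})^C ≤ 1`, `ρ·(log s)^{c₂/C} ≤ 1`, and `c ≤ c₂/C` finishes. -/
theorem PrimeLogDecay_of :
    Spec.stub_rehostableSubfamily → Spec.stub_freimanRehost → Spec.stub_pinnedLogDecay →
      PrimeLogDecay := by
  intro h1 hR h2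
  obtain ⟨κ, hκ0, hκ1, c₂, hc₂, s₂, H2⟩ := h2
  obtain ⟨c₁, hc₁, C, hC, s₁, H1⟩ := h1 κ hκ0 hκ1
  have hCpos : (0 : ℝ) < (C : ℝ) := by exact_mod_cast hC
  have hCne : (C : ℝ) ≠ 0 := hCpos.ne'
  have hC0 : C ≠ 0 := by omega
  refine ⟨min c₁ (c₂ / C), lt_min hc₁ (div_pos hc₂ hCpos), max (max s₁ s₂) 3, ?_⟩
  intro p hp n s A B hs hbal hW hX
  have hs₁ : s₁ ≤ s := le_trans (le_trans (le_max_left _ _) (le_max_left _ _)) hs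
  have hs₂ : s₂ ≤ s := le_trans (le_trans (le_max_right _ _) (le_max_left _ _)) hs
  have hs3 : 3 ≤ s := le_trans (le_max_right _ _) hs
  have hs3R : (3 : ℝ) ≤ (s : ℝ) := by exact_mod_cast hs3
  have hL1 : 1 ≤ Real.log (s : ℝ) := by
    rw [← Real.log_exp 1]
    apply Real.log_le_log (Real.exp_pos 1)
    have := Real.exp_one_lt_d9
    linarith
  have hL0 : 0 ≤ Real.log (s : ℝ) := le_trans zero_le_one hL1
  have hns0 : 0 ≤ (n : ℝ) * (s : ℝ) := by positivity
  have hmono : ∀ e : ℝ, min c₁ (c₂ / C) ≤ e →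
      Real.log (s : ℝ) ^ (min c₁ (c₂ / C)) ≤ Real.log (s : ℝ) ^ e :=
    fun e he => Real.rpow_le_rpow_of_exponent_le hL1 he
  rcases H1 p hp n s A B hs₁ hbal hW hX with hsparse | ⟨p', I, φ, hp', hpin, hrefl, hdens⟩
  · calc (n : ℝ) * (s : ℝ) * Real.log (s : ℝ) ^ (min c₁ (c₂ / C))
          ≤ (n : ℝ) * (s : ℝ) * Real.log (s : ℝ) ^ c₁ :=
          mul_le_mul_of_nonneg_left (hmono c₁ (min_le_left _ _)) hns0
      _ ≤ (p : ℝ) := hsparse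
  · obtain ⟨A', B', hbal', hW', hX'⟩ := hR p p' n s A B I φ hbal hW hX hrefl
    have key := H2 p' hp' I.card s A' B' hs₂ hbal' hW' hX' hpin
    have hp0 : (0 : ℝ) < (p : ℝ) := by exact_mod_cast hp.pos
    have hp'0 : (0 : ℝ) < (p' : ℝ) := by exact_mod_cast hp'.pos
    have hρ0 : 0 ≤ (n : ℝ) * (s : ℝ) / (p : ℝ) := by positivity
    have ht0 : 0 ≤ Real.log (s : ℝ) ^ (c₂ / C) := Real.rpow_nonneg hL0 _
    have htC : (Real.log (s : ℝ) ^ (c₂ / C)) ^ C = Real.log (s : ℝ) ^ c₂ := by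
      rw [← Real.rpow_natCast, ← Real.rpow_mul hL0]
      congr 1
      field_simp
    have h1 : (I.card : ℝ) * (s : ℝ) / (p' : ℝ) * (Real.log (s : ℝ) ^ (c₂ / C)) ^ C ≤ 1 := by
      rw [htC, div_mul_eq_mul_div, div_le_one hp'0]
      exact key
    have h2 : ((n : ℝ) * (s : ℝ) / (p : ℝ) * Real.log (s : ℝ) ^ (c₂ / C)) ^ C ≤ 1 :=
      calc ((n : ℝ) * (s : ℝ) / (p : ℝ) * Real.log (s : ℝ) ^ (c₂ / C)) ^ C
            = ((n : ℝ) * (s : ℝ) / (p : ℝ)) ^ C * (Real.log (s : ℝ) ^ (c₂ / C)) ^ C := mul_pow _ _ _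
        _ ≤ (I.card : ℝ) * (s : ℝ) / (p' : ℝ) * (Real.log (s : ℝ) ^ (c₂ / C)) ^ C :=
            mul_le_mul_of_nonneg_right hdens (pow_nonneg ht0 C)
        _ ≤ 1 := h1
    have h3 : (n : ℝ) * (s : ℝ) / (p : ℝ) * Real.log (s : ℝ) ^ (c₂ / C) ≤ 1 :=
      (pow_le_one_iff_of_nonneg (mul_nonneg hρ0 ht0) hC0).1 h2
    have h4 : (n : ℝ) * (s : ℝ) / (p : ℝ) * Real.log (s : ℝ) ^ (min c₁ (c₂ / C)) ≤ 1 :=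
      le_trans (mul_le_mul_of_nonneg_left (hmono _ (min_le_right _ _)) hρ0) h3
    have h5 : (n : ℝ) * (s : ℝ) * Real.log (s : ℝ) ^ (min c₁ (c₂ / C)) / (p : ℝ) ≤ 1 := by
      rw [← div_mul_eq_mul_div]
      exact h4
    exact (div_le_one hp0).1 h5

/-- The skeleton IS the crux proof once the three stubs are discharged (kernel-checked application; today it
depends on `sorryAx` through the stubs only). -/
theorem PrimeLogDecay_proof : PrimeLogDecay :=
  PrimeLogDecay_of stub_rehostableSubfamily stub_freimanRehost stub_pinnedLogDecay

end Summit.MatrixMultiplication.MatrixMultiplication.Cruxes.PrimeLogDecay.DeltaTraceRigidity
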